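import Mathlib
import HarnessLib
import Summits.NavierStokesRegularity.NavierStokesRegularity.Theorems.SymmetryModuliCountStretchingCertificateComparison
import Literature.Analysis.FluidPDE.CurlFreeLiouville
import Literature.Analysis.FluidPDE.TypeIAncientMild

/-!
# TypeILiouvilleStrainLedgerTypeIGauge — crux (L) stmt-NavierStokesRegularity-10661 `TypeIliouvilleL`,
# registered stub `stub_typeIAncientLiouville_knssGauge` (Type-I ancient Liouville, door stmt-4050):
# A STRAIN LEDGER, NOT A THRESHOLD, KILLS TYPE-I ANCIENT FLOWS

Helper for stmt-NavierStokesRegularity-10661 (`--supports`); theorems only, no definitions, no named-fact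
hypotheses; closes no item; Navier–Stokes regularity is NOT proved here.  Kernel source: the decomp-ns cell's
lens-2 g17 node «THE STRAIN LEDGER» §8 (`run/shared/lean/pub/decomp-ns/decomp-ns-lens-2/StrainLedger.lean`, critic
row 200 CLEARED, «BANK as Theorems»), banked by the leafhand seat of the EulerZoomLiouville route, with the
theorems ALSO stated on the literal hypotheses of the registered stub `stub_typeIAncientLiouville_knssGauge`
(KNSS gauge: jointly smooth, div-free slices, Oseen-kernel Duhamel identity, Type-I time decay ⟹ `u ≡ 0`).

* `typeI_eq_zero_of_temporalGauge` — **TEMPORAL-GAUGE CERTIFICATE THEOREM**: a Type-I ancient mild flow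
  (`IsTypeIAncientMild C u`) admitting a temporal gauge `g`, smooth on `(−∞,0)`, `g ≥ 1`, and `δ > 0` with
  `((−t)⟪∇u(t,y) ξ, ξ⟫ − 1 + δ) · g t ≤ (−t) · g′(t)` (unit `ξ`) vanishes identically.  Engine: the tree's
  stretching-certificate comparison theorem `stretchCert_curl_eq_zero` (crux `SymmetryModuliCount` 14340) with the
  SPATIALLY CONSTANT certificate `h(t,y) = g(t)`, then curl-free bounded div-free Liouville and Type-I decay.
  INTEGRATED READING: `log g` is a backward LEDGER of the excess stretching `(−τ)λ_max(S) − (1−δ)` — a time MEAN of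
  the stretching number below one suffices, not a pointwise threshold.
* `typeI_eq_zero_of_stretching_le` — threshold form (`g ≡ 1`): `(−t)⟪∇u ξ,ξ⟫ ≤ a‖ξ‖²`, `a < 1` ⟹ `u ≡ 0` (the regime
  of the PROVED rung `ClockStretchingLaw.SmallStrainRung` stmt-10574 / `SubcriticalStrain`, restated on `λ_max(S)`).
* `typeI_eq_zero_of_lateStrainAllowance` — **LATE-STRAIN ALLOWANCE** (`g = 1 + (−t)^{−n}`): stretching number
  `≤ (1−δ) + n/((−t)^n + 1)` suffices — it may EXCEED ONE by any prescribed amount near `t → 0⁻` provided the far-past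
  ledger is subcritical.
* `knssGauge_eq_zero_of_temporalGauge` / `_of_stretching_le` / `_of_lateStrainAllowance` — the same three on the
  stub's literal KNSS-gauge hypotheses (`isTypeIAncientMild_iff`): the registered stub HOLDS on the
  temporally-gauged stratum.  What remains of the stub is exactly the Type-I ancient flows with NO subcritical
  backward stretching ledger (mean stretching number `≥ 1` on long windows).

[cite: KochNadirashviliSereginSverak2009, §4 p. 8, (1.4) (arXiv:0709.3599)]
-/

noncomputable section
open MeasureTheory Filter Set Function Metric
open scoped Topology RealInnerProductSpace ContDiff Laplacian ENNReal NNReal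
open Literature.Analysis Literature.Analysis.FluidPDE Literature.Analysis.UnboundedOperators
set_option linter.dupNamespace false
namespace Summit.NavierStokesRegularity.NavierStokesRegularity.Theorems.TypeILiouvilleStrainLedger

/-! ## §1 The temporal-gauge certificate theorem on the Type-I class -/

/-- **TEMPORAL-GAUGE CERTIFICATE THEOREM.**  Let `u` be a Type-I ancient mild flow (`IsTypeIAncientMild C u`).
If there is a temporal gauge `g : ℝ → ℝ`, smooth on `(−∞,0)`, `g ≥ 1`, and `δ > 0` with
`((−t) ⟪∇u(t,y) ξ, ξ⟫ − 1 + δ) · g t ≤ (−t) · g′(t)` for all `t < 0`, `y`, unit `ξ`, then `u ≡ 0`.  Proof: the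
tree's stretching-certificate comparison engine `stretchCert_curl_eq_zero` with the spatially constant certificate
`h(t,y) = g(t)` (its gradient and Laplacian vanish, so the certificate inequality reduces to the hypothesis after
discarding the direction-coherence term `|∇ξ|²_F ≥ 0`), then `eq_of_curl_eq_zero_of_isDivFree_of_bounded` and
`IsTypeIAncientMild.eq_zero_of_slice_const`. [cite: KochNadirashviliSereginSverak2009, §4 (arXiv:0709.3599)] -/
theorem typeI_eq_zero_of_temporalGauge {C : ℝ}
    {u : ℝ → EuclideanSpace ℝ (Fin 3) → EuclideanSpace ℝ (Fin 3)} (hu : IsTypeIAncientMild C u)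
    {g : ℝ → ℝ} (hg : ContDiffOn ℝ (⊤ : ℕ∞) g (Iio 0)) (hg1 : ∀ t < 0, 1 ≤ g t)
    {δ : ℝ} (hδ : 0 < δ)
    (hcert : ∀ t < 0, ∀ y ξ : EuclideanSpace ℝ (Fin 3), ‖ξ‖ = 1 →
      ((-t) * ⟪fderiv ℝ (u t) y ξ, ξ⟫ - 1 + δ) * g t ≤ (-t) * deriv g t) :
    ∀ t < 0, ∀ x, u t x = 0 := by
  -- the spatially constant certificate
  set h : ℝ → EuclideanSpace ℝ (Fin 3) → ℝ := fun t _ => g t with hh_def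
  have hh : IsSmoothSpaceTimeOn (Iio 0) h := by
    have h1 : ContDiffOn ℝ (⊤ : ℕ∞) (fun p : ℝ × EuclideanSpace ℝ (Fin 3) => g p.1)
        (Iio 0 ×ˢ univ) :=
      hg.comp contDiffOn_fst fun p hp => (mem_prod.1 hp).1
    exact h1.congr fun p _ => rfl
  have hh1 : ∀ t < 0, ∀ y, 1 ≤ h t y := fun t ht _ => hg1 t ht
  have hfd0 : ∀ t (y : EuclideanSpace ℝ (Fin 3)), fderiv ℝ (h t) y = 0 := fun t y => by
    simp [hh_def]
  have hgrad : ∀ t < 0, ∀ y, ‖fderiv ℝ (h t) y‖ ≤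
      0 * (1 / Real.sqrt (-t) + ‖y‖ / (-t)) * h t y := fun t _ y => by
    rw [hfd0]; simp
  have hcert' : ∀ t < 0, ∀ y, curl (u t) y ≠ 0 →
      ((-t) * (⟪fderiv ℝ (u t) y (vorticityDirection (curl (u t)) y),
          vorticityDirection (curl (u t)) y⟫ -
          frobeniusNormSq (fderiv ℝ (vorticityDirection (curl (u t))) y)) - 1 + δ) * h t y ≤
        (-t) * (timeDeriv h t y + fderiv ℝ (h t) y (u t y) - (Δ (h t)) y) := by
    intro t ht y hω
    have hξ : ‖vorticityDirection (curl (u t)) y‖ = 1 := by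
      rw [vorticityDirection_apply, norm_smul, norm_inv, norm_norm,
        inv_mul_cancel₀ (norm_ne_zero_iff.2 hω)]
    have htd : timeDeriv h t y = deriv g t := by simp [timeDeriv, hh_def]
    have hΔ : (Δ (h t)) y = 0 := laplacian_const_eq_zero (g t) y
    rw [htd, hfd0, hΔ, zero_apply, add_zero, sub_zero]
    have hF := frobeniusNormSq_nonneg (fderiv ℝ (vorticityDirection (curl (u t))) y)
    have hgt : 0 ≤ g t := zero_le_one.trans (hg1 t ht)
    have ht0 : 0 < -t := neg_pos.2 ht
    have key := hcert t ht y _ hξ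
    have hmono : ((-t) * (⟪fderiv ℝ (u t) y (vorticityDirection (curl (u t)) y),
          vorticityDirection (curl (u t)) y⟫ -
          frobeniusNormSq (fderiv ℝ (vorticityDirection (curl (u t))) y)) - 1 + δ) * g t ≤
        ((-t) * ⟪fderiv ℝ (u t) y (vorticityDirection (curl (u t)) y),
          vorticityDirection (curl (u t)) y⟫ - 1 + δ) * g t := by
      apply mul_le_mul_of_nonneg_right _ hgt
      nlinarith
    exact hmono.trans key
  have hω : ∀ s < 0, ∀ y, curl (u s) y = 0 := fun s hs y =>
    stretchCert_curl_eq_zero hu hh hh1 hδ hgrad hcert' hs y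
  have hub : ∀ s < 0, ∀ y, u s y = u s 0 := fun s hs y =>
    eq_of_curl_eq_zero_of_isDivFree_of_bounded ((hu.contDiff_slice hs).of_le (by norm_cast))
      (hω s hs) (hu.isDivFree hs) (fun z => hu.norm_le hs z) y 0
  intro t ht x
  exact hu.eq_zero_of_slice_const hub ht x

/-- Corollary (THRESHOLD FORM in strain shape, `g ≡ 1`): a Type-I ancient mild flow whose stretching form obeys
`(−t) ⟪∇u(t,y) ξ, ξ⟫ ≤ a ‖ξ‖²` with `a < 1` vanishes — the regime of the PROVED rung `ClockStretchingLaw.SmallStrainRung`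
(stmt-10574) / `SubcriticalStrain`, stated on `λ_max(S)` instead of `‖∇u‖`.
[cite: KochNadirashviliSereginSverak2009, §4 (arXiv:0709.3599)] -/
theorem typeI_eq_zero_of_stretching_le {C : ℝ}
    {u : ℝ → EuclideanSpace ℝ (Fin 3) → EuclideanSpace ℝ (Fin 3)} (hu : IsTypeIAncientMild C u)
    {a : ℝ} (ha : a < 1)
    (hstrain : ∀ t < 0, ∀ y ξ : EuclideanSpace ℝ (Fin 3),
      (-t) * ⟪fderiv ℝ (u t) y ξ, ξ⟫ ≤ a * ‖ξ‖ ^ 2) :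
    ∀ t < 0, ∀ x, u t x = 0 := by
  refine typeI_eq_zero_of_temporalGauge hu (g := fun _ => 1) contDiffOn_const
    (fun _ _ => le_rfl) (δ := 1 - a) (by linarith) ?_
  intro t ht y ξ hξ
  have h := hstrain t ht y ξ
  rw [hξ] at h
  simp only [deriv_const', mul_zero, mul_one]
  nlinarith

/-- Corollary (**LATE-STRAIN ALLOWANCE** — the ledger, not the sup, decides): with the temporal gauge
`g t = 1 + ((−t)^n)⁻¹` (`n ≥ 1`), a Type-I ancient mild flow whose stretching number obeys
`(−t) ⟪∇u ξ,ξ⟫ ≤ (1 − δ) + n / ((−t)^n + 1)` (unit `ξ`) vanishes: near the singular time `t → 0⁻` the allowance is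
`1 − δ + n`, i.e. the stretching number may EXCEED ONE by any prescribed amount on the recent past, provided the
far-past ledger is subcritical.  No threshold statement in the cone (`SmallStrainRung`, `SubcriticalStrain`,
`ClockCeiling`) covers this class. [cite: KochNadirashviliSereginSverak2009, §4 (arXiv:0709.3599)] -/
theorem typeI_eq_zero_of_lateStrainAllowance {C : ℝ}
    {u : ℝ → EuclideanSpace ℝ (Fin 3) → EuclideanSpace ℝ (Fin 3)} (hu : IsTypeIAncientMild C u)
    {δ : ℝ} (hδ : 0 < δ) (n : ℕ) (hn : 1 ≤ n)
    (hstrain : ∀ t < 0, ∀ y ξ : EuclideanSpace ℝ (Fin 3), ‖ξ‖ = 1 →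
      (-t) * ⟪fderiv ℝ (u t) y ξ, ξ⟫ ≤ (1 - δ) + n / ((-t) ^ n + 1)) :
    ∀ t < 0, ∀ x, u t x = 0 := by
  -- the gauge and its derivative on `(-∞, 0)`
  set g : ℝ → ℝ := fun t => 1 + ((-t) ^ n)⁻¹ with hg_def
  have hpow_pos : ∀ t : ℝ, t < 0 → 0 < (-t) ^ n := fun t ht => pow_pos (neg_pos.2 ht) n
  have hg_smooth : ContDiffOn ℝ (⊤ : ℕ∞) g (Iio 0) := by
    have hp : ContDiffOn ℝ (⊤ : ℕ∞) (fun s : ℝ => (-s) ^ n) (Iio 0) :=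
      (contDiff_neg.pow n).contDiffOn
    exact contDiffOn_const.add (hp.inv fun t ht => (hpow_pos t ht).ne')
  have hg1 : ∀ t < 0, 1 ≤ g t := fun t ht => by
    simp only [hg_def]; linarith [inv_pos.2 (hpow_pos t ht)]
  have hderiv : ∀ t : ℝ, t < 0 → deriv g t = n * (-t) ^ (n - 1) / ((-t) ^ n) ^ 2 := by
    intro t ht
    have hne : (-t) ^ n ≠ 0 := (hpow_pos t ht).ne'
    have h1 : HasDerivAt (fun s : ℝ => (-s) ^ n) ((n : ℝ) * (-t) ^ (n - 1) * (-1)) t :=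
      (hasDerivAt_neg t).pow n
    have h2 : HasDerivAt (fun s : ℝ => ((-s) ^ n)⁻¹)
        (-((n : ℝ) * (-t) ^ (n - 1) * (-1)) / ((-t) ^ n) ^ 2) t := h1.inv hne
    have h3 : HasDerivAt g (-((n : ℝ) * (-t) ^ (n - 1) * (-1)) / ((-t) ^ n) ^ 2) t := by
      simpa [hg_def] using h2.const_add 1
    rw [h3.deriv]; ring
  refine typeI_eq_zero_of_temporalGauge hu hg_smooth hg1 hδ ?_
  intro t ht y ξ hξ
  have ht0 : 0 < -t := neg_pos.2 ht
  have hp : 0 < (-t) ^ n := hpow_pos t ht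
  have hm : 0 < (-t) ^ (n - 1) := pow_pos ht0 _
  have hs := hstrain t ht y ξ hξ
  rw [hderiv t ht]
  -- `(-t) · (-t)^(n-1) = (-t)^n`
  have hpp : (-t) * (-t) ^ (n - 1) = (-t) ^ n := by
    rw [← pow_succ']; congr 1; omega
  have hrhs : (-t) * (↑n * (-t) ^ (n - 1) / ((-t) ^ n) ^ 2) = n / (-t) ^ n := by
    rw [← hpp, mul_div_assoc', div_eq_div_iff (pow_ne_zero 2 (mul_pos ht0 hm).ne') (mul_pos ht0 hm).ne']
    ring
  rw [hrhs]
  simp only [hg_def]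
  -- now: `((-t)⟪∇u ξ,ξ⟫ - 1 + δ) · (1 + p⁻¹) ≤ n / p` where `p = (-t)^n`, from `(-t)⟪∇u ξ,ξ⟫ ≤ 1 - δ + n/(p+1)`
  set q : ℝ := (-t) * ⟪fderiv ℝ (u t) y ξ, ξ⟫ with hq
  set p : ℝ := (-t) ^ n with hp_def
  have hp0 : p ≠ 0 := hp.ne'
  have hp1 : 0 < p + 1 := by linarith
  have hq' : q - 1 + δ ≤ n / (p + 1) := by linarith
  have h1p : (1 : ℝ) + p⁻¹ = (p + 1) / p := by
    rw [eq_div_iff hp0, add_mul, one_mul, inv_mul_cancel₀ hp0]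
  rw [h1p]
  calc (q - 1 + δ) * ((p + 1) / p) ≤ (n / (p + 1)) * ((p + 1) / p) :=
        mul_le_mul_of_nonneg_right hq' (div_nonneg hp1.le hp.le)
    _ = n / p := by
        rw [div_mul_div_comm, div_eq_div_iff (mul_pos hp1 hp).ne' hp0]
        ring

/-! ## §2 The same on the registered stub's literal KNSS-gauge hypotheses

`stub_typeIAncientLiouville_knssGauge` of the 10661 skeleton reads: `∀ C u, (ContDiffOn ℝ ⊤ (uncurry u) (Iio 0 ×ˢ univ)
∧ (∀ t < 0, IsDivFree (u t)) ∧ (∀ s < t < 0, ∀ x, u t x = heatFlow (u s) (t − s) x − ∫_{τ ∈ (s,t)} ∫_y K(t−τ, x−y)[u τ y,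
u τ y]) ∧ HasTypeITimeDecay C u) → ∀ t < 0, ∀ x, u t x = 0`.  Its hypothesis is `IsTypeIAncientMild C u` by
`isTypeIAncientMild_iff`; the three theorems below are the stub WITH ONE EXTRA BINDER (the temporal gauge / the
threshold / the late allowance). -/

/-- The registered stub `stub_typeIAncientLiouville_knssGauge` HOLDS on the temporally-gauged stratum: its literal
hypotheses plus a temporal gauge `g ≥ 1`, smooth on `(−∞,0)`, with `((−t)⟪∇u ξ,ξ⟫ − 1 + δ)·g ≤ (−t)·g′` (unit `ξ`,
`δ > 0`) give `u ≡ 0`. [cite: KochNadirashviliSereginSverak2009, §4 p. 8 (arXiv:0709.3599)] -/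
theorem knssGauge_eq_zero_of_temporalGauge (C : ℝ)
    (u : ℝ → EuclideanSpace ℝ (Fin 3) → EuclideanSpace ℝ (Fin 3))
    (hu : ContDiffOn ℝ (⊤ : ℕ∞) (Function.uncurry u) (Set.Iio 0 ×ˢ Set.univ) ∧
      (∀ t < 0, Literature.Analysis.FluidPDE.VectorCalculus.IsDivFree (u t)) ∧
      (∀ s t : ℝ, s < t → t < 0 → ∀ x, u t x = Literature.Analysis.FluidPDE.heatFlow (u s) (t - s) x -
        ∫ τ in Set.Ioo s t, ∫ y, Literature.Analysis.FluidPDE.oseenKernel (t - τ) (x - y) (u τ y) (u τ y)) ∧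
      Literature.Analysis.FluidPDE.HasTypeITimeDecay C u)
    {g : ℝ → ℝ} (hg : ContDiffOn ℝ (⊤ : ℕ∞) g (Iio 0)) (hg1 : ∀ t < 0, 1 ≤ g t)
    {δ : ℝ} (hδ : 0 < δ)
    (hcert : ∀ t < 0, ∀ y ξ : EuclideanSpace ℝ (Fin 3), ‖ξ‖ = 1 →
      ((-t) * ⟪fderiv ℝ (u t) y ξ, ξ⟫ - 1 + δ) * g t ≤ (-t) * deriv g t) :
    ∀ t < 0, ∀ x, u t x = 0 :=
  typeI_eq_zero_of_temporalGauge (isTypeIAncientMild_iff.2 hu) hg hg1 hδ hcert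

/-- The registered stub `stub_typeIAncientLiouville_knssGauge` HOLDS under the strain-shape threshold
`(−t)⟪∇u(t,y) ξ, ξ⟫ ≤ a‖ξ‖²`, `a < 1` (the regime of the PROVED rung `SmallStrainRung`, on `λ_max(S)`).
[cite: KochNadirashviliSereginSverak2009, §4 p. 8 (arXiv:0709.3599)] -/
theorem knssGauge_eq_zero_of_stretching_le (C : ℝ)
    (u : ℝ → EuclideanSpace ℝ (Fin 3) → EuclideanSpace ℝ (Fin 3))
    (hu : ContDiffOn ℝ (⊤ : ℕ∞) (Function.uncurry u) (Set.Iio 0 ×ˢ Set.univ) ∧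
      (∀ t < 0, Literature.Analysis.FluidPDE.VectorCalculus.IsDivFree (u t)) ∧
      (∀ s t : ℝ, s < t → t < 0 → ∀ x, u t x = Literature.Analysis.FluidPDE.heatFlow (u s) (t - s) x -
        ∫ τ in Set.Ioo s t, ∫ y, Literature.Analysis.FluidPDE.oseenKernel (t - τ) (x - y) (u τ y) (u τ y)) ∧
      Literature.Analysis.FluidPDE.HasTypeITimeDecay C u)
    {a : ℝ} (ha : a < 1)
    (hstrain : ∀ t < 0, ∀ y ξ : EuclideanSpace ℝ (Fin 3),
      (-t) * ⟪fderiv ℝ (u t) y ξ, ξ⟫ ≤ a * ‖ξ‖ ^ 2) :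
    ∀ t < 0, ∀ x, u t x = 0 :=
  typeI_eq_zero_of_stretching_le (isTypeIAncientMild_iff.2 hu) ha hstrain

/-- The registered stub `stub_typeIAncientLiouville_knssGauge` HOLDS under the LATE-STRAIN ALLOWANCE
`(−t)⟪∇u ξ,ξ⟫ ≤ (1 − δ) + n/((−t)^n + 1)` (unit `ξ`, `δ > 0`, `n ≥ 1`): super-threshold stretching near `0⁻` is
tolerated if the far-past ledger is subcritical. [cite: KochNadirashviliSereginSverak2009, §4 p. 8 (arXiv:0709.3599)] -/
theorem knssGauge_eq_zero_of_lateStrainAllowance (C : ℝ)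
    (u : ℝ → EuclideanSpace ℝ (Fin 3) → EuclideanSpace ℝ (Fin 3))
    (hu : ContDiffOn ℝ (⊤ : ℕ∞) (Function.uncurry u) (Set.Iio 0 ×ˢ Set.univ) ∧
      (∀ t < 0, Literature.Analysis.FluidPDE.VectorCalculus.IsDivFree (u t)) ∧
      (∀ s t : ℝ, s < t → t < 0 → ∀ x, u t x = Literature.Analysis.FluidPDE.heatFlow (u s) (t - s) x -
        ∫ τ in Set.Ioo s t, ∫ y, Literature.Analysis.FluidPDE.oseenKernel (t - τ) (x - y) (u τ y) (u τ y)) ∧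
      Literature.Analysis.FluidPDE.HasTypeITimeDecay C u)
    {δ : ℝ} (hδ : 0 < δ) (n : ℕ) (hn : 1 ≤ n)
    (hstrain : ∀ t < 0, ∀ y ξ : EuclideanSpace ℝ (Fin 3), ‖ξ‖ = 1 →
      (-t) * ⟪fderiv ℝ (u t) y ξ, ξ⟫ ≤ (1 - δ) + n / ((-t) ^ n + 1)) :
    ∀ t < 0, ∀ x, u t x = 0 :=
  typeI_eq_zero_of_lateStrainAllowance (isTypeIAncientMild_iff.2 hu) hδ n hn hstrain

end Summit.NavierStokesRegularity.NavierStokesRegularity.Theorems.TypeILiouvilleStrainLedger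

end
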